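import Literature.MathematicalPhysics.QuantumFieldTheory.Balaban1983to89.B9RWSums346Lap
import Literature.MathematicalPhysics.QuantumFieldTheory.Balaban1983to89.B9Thm37AllNormsInstances

/-!
# `Balaban1983to89.B9RWSums344Input` — [B9] the INPUT-side Hölder members (3.44), (3.45) of the random walk sum (3.107) G(U) PROVED
# inside the leaf of Theorem 3.10 at the all-blocks pin, in the block-norm calculus of `B11SectG` with an input block-norm
# LETTER b_H(ε) (the Hölder-plus-sup size ‖λ‖^{ξ′}_ε + |λ| of (3.44) on the enlarged cubes): head legs plus ONE composition

T. Bałaban, *Propagators for lattice gauge theories in a background field*, Commun. Math. Phys. **99** (1985) 389–434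
[`Balaban1985BackgroundPropagators`, "B9"]; [4] = T. Bałaban, *Propagators and renormalization transformations for lattice
gauge theories. II*, Commun. Math. Phys. **96** (1984) 223–250 [`Balaban1984PropagatorsII`].

statement-level skeleton of published theorems with citation tags; proofs where landed; nothing here is a claim about the
Yang–Mills mass gap

THE PRINTED LOCI (verbatim).  (3.44)–(3.45), p. 398: *"Furthermore, there exist constants B′₀(ε), B′₀(ε, β) dependent on d, L and
the indicated parameters, 0 < ε ≦ 1, 0 ≦ β < 1 (B′₀(ε) → ∞ if ε → 0, B′₀(ε, β) → ∞ if either ε → 0, or β → 1), such that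
|(∇_UG′(U)∇\*_Uλ)(x)| ≦ B′₀(ε)e^{−δ₀d(y,y′)}(‖λ‖^{ξ′}_ε + |λ|) for 0 < ε ≦ 1, x ∈ Δ(y), supp λ ⊂ Δ̃(y′), y′ ∈ Λ_{j′}, ξ′ = L^{−j′} (3.44)
‖ζ∇_UG′(U)∇\*_Uλ‖_β ≦ B′₀(ε, β)(L^jη)^{−β}(‖ζ‖^ξ_β + |ζ|)e^{−δ₀d(y,y′)}(‖λ‖^{ξ′}_{β+ε} + |λ|) for 0 < ε ≦ 1, 0 ≦ β ≦ β₀ < 1, ζ ∈ C₀^∞(Δ̃(y)),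
y ∈ Λ_j, ξ = L^{−j}, supp λ ⊂ Δ̃(y′), y′ ∈ Λ_{j′}, ξ′ = L^{−j′} (3.45)"*; (3.106) p. 414: *"G = G₀(I − R)⁻¹"*; p. 413: *"An operator
R_α(X) … satisfies a bound of the type (3.89), possibly with an additional power of L^jη"*; Theorem 3.10, p. 416: *"… and the
corresponding inequalities for norms on the left-hand sides of (3.42)–(3.47)"*.

THE POINT.  The siblings prove inside the leaves at the ALL-BLOCKS pins the OUTPUT-side members of Theorem 3.3 for the sum G(U):
(3.42), (3.47) (`B9RWSums343to347Whole`), (3.46)₁,₂,₃,₄,₆ (`B9RWSums346Schur`, `B9RWSums346Lap`), (3.43) (`B9RWSums343Holder`); the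
INPUT-side Hölder members (3.44), (3.45) stayed displayed — the two-space sup calculus has no input Hölder size.  THIS FILE types
that size as a LETTER: a family `bH ε` of `B11SectG.BlockNorm`s on the Y-functions (λ lives where ∇\*_U acts), read by `InputReads`,
and proves both members in n06-b's block-norm calculus WITHOUT a fixed point: by (3.106), ∇_UG∇\*_U = ∇_UG₀∇\*_U + (∇_UG)(R∇\*_U) and
ζ-quotient∘∇_UG∇\*_U = ζ-quotient∘∇_UG₀∇\*_U + (Φ^Y_β∘∇_UG)(R∇\*_U) — the HEAD LEGS (Cor. 3.6's (3.44) ∕ (3.45) for the h_□G_□h_□,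
POSITED), the sup majorant of ∇_UG (the pin) ∕ the probe majorant of Φ^Y_β∘∇_UG (`B9RWSums343Holder.holder343_of_local310`), and
the factors' INPUT bounds R_a∇\*_U : b_H(ε) → sup with the *"additional power"* (L^jη)⁻¹ (POSITED), composed once
(`B11SectG.hasMaj_comp`) with p. 398's transfer of the power and [4] (2.61):

* §1 `InputReads` (co-reading of `K.e4`, `K.h2` by ∇_UG∇\*_U through b_H and the probes), `lines3445_of_hasMaj` (two block-norm
  majorants of the printed shapes ⇒ the (3.44), (3.45) lines AS TYPED); the engine `tail_comp` (a sup- or probe-majorised S after an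
  input-bounded P with the weight (L^jη)⁻¹: S∘P : b_H → sharp blocks with ONE transfer and ONE convolution).
* §2 schemas `InputLegs310`, `FactorsInput310` (POSITED, printed shape), `inputConst44` ∕ `inputConst45`, the one-member theorem
  `input3445_of_local310`, and ★ `thm310Printed_allPin_inputHolder` — the leaf at `W310OfOps … (ConvAll3107 …)` with EVERY member of
  Theorem 3.3 proved inside EXCEPT the single two-sided L² line n = 4 (‖h∇_UG∇\*_UJ‖), which stays displayed.

HONEST SCOPE.  Nothing of print is asserted.  The block norms `bH ε` are LETTERS (which sizes realise ‖λ‖^{ξ′}_ε + |λ| on Δ̃(y′) is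
the instance's business, read through `InputReads`); the legs and the factors' input bounds are hypotheses of printed shape (Cor. 3.6
(3.44)–(3.45) for the G_□ with the product rules through h_□; p. 413 for R_α(X)∇\*_U); the L² line n = 4 stays displayed (its bound in
print is L²-theoretic, not a sup majorant); the G′ twin is not typed here.  Kernel-checked bookkeeping shrinking a located residual;
NOT a node discharge, NOT summit progress; one finite lattice paper; nothing continuum, nothing about the mass gap.  Cell `pub-ymgap`
(HUMAN RULING D-0062), Track A node N06 [B9], seat `pub-ymgap-dag-n06-k` (rows 18–19, successor gen), 2026-08-27.
-/

namespace Literature.MathematicalPhysics.QuantumFieldTheory.Balaban1983to89.B9RWSums344Input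

open Literature.MathematicalPhysics.QuantumFieldTheory.Balaban1983to89
open Finset B6RandomWalk B6RandomWalkHom B9Thm37Sum B9Thm34Ext B9Thm37Glue B9Thm37Whole B9Cor38Whole B9Thm310Whole
open B9RWSums343to347Whole B9RWSums346Schur B9Thm37GlueCor36 B9RWSums343Holder B9RWSums346Lap
open B11SectG B9Thm37AllNorms B9Thm37AllNormsInstances B9Ineq347 B9Ineq347AllEntries

noncomputable section

/-! ## §1 The input block-norm letter, the co-reading, the lines from block-norm majorants, and the tail composition -/

section Readings

variable {g : B9.Geometry} [Fintype g.Site] {R : ℝ} {H : Prop} {B : B9.Backgrounds} {X Y PX PY : Type} [Fintype Y]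
  [Fintype PY]

/-- **CO-READING OF THE INPUT-HÖLDER QUANTITIES `K.e4` ((3.44)) AND `K.h2` ((3.45)) OF A KERNEL FAMILY** by the model operator
A = ∇_UG∇\*_U on the Y-functions, through a family `bH ε` of block norms (the letter for ‖λ‖^{ξ′}_ε + |λ| on Δ̃(y′), (3.44) p. 398)
and the probes `𝔭.ΦY U β` of (3.40): supp λ ⊂ Δ̃(y′) ⇒ the evaluation `evY λ` is localised at y′ for `bH ε` and its size there is
≦ ‖λ‖^{ξ′}_ε + |λ| (`isLoc`, `loc_le`); `obs4`: e4(U, λ, y) ≦ c whenever |A(evY λ)| ≦ c on the block of y; `obs5`: h2(U, λ, β, ζ) ≦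
c·(‖ζ‖^ξ_β + |ζ|) whenever every probe anchored at y is ≦ c on A(evY λ).  A HYPOTHESIS SCHEMA; nothing asserted.
[cite: Balaban1985BackgroundPropagators, (3.44)–(3.45) p.398 + (3.40) p.397] -/
structure InputReads (K : B9.KernelFamily g B) (U : B.Cfg) (𝔭 : HolderProbes g B X Y PX PY)
    (bH : ℝ → BlockNorm (toB6 g R H) (Y → ℝ)) (blkY : Y → g.Site) (evY : g.Loc → Y → ℝ)
    (A : (Y → ℝ) →ₗ[ℝ] (Y → ℝ)) : Prop where
  isLoc : ∀ (ε : ℝ) (lam : g.Loc) (y' : g.Site), g.suppInT lam y' → (bH ε).IsLoc y' (evY lam)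
  loc_le : ∀ (ε : ℝ) (lam : g.Loc) (y' : g.Site), g.suppInT lam y' → (bH ε).loc y' (evY lam) ≤ g.holder ε lam + g.supNorm lam
  hs_nonneg : ∀ (ε : ℝ) (lam : g.Loc), 0 ≤ g.holder ε lam + g.supNorm lam
  cutH_nonneg : ∀ (β : ℝ) (ζ : g.Cut), 0 ≤ g.cutH β ζ
  obs4 : ∀ (lam : g.Loc) (y : g.Site) (c : ℝ), 0 ≤ c → (∀ v : Y, blkY v = y → |A (evY lam) v| ≤ c) → K.e4 U lam y ≤ c
  obs5 : ∀ (lam : g.Loc) (β : ℝ) (ζ : g.Cut) (y : g.Site) (c : ℝ), 0 ≤ c → g.cutInT ζ y →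
    (∀ p : PY, 𝔭.blkPY p = y → |𝔭.ΦY U β (A (evY lam)) p| ≤ c) → K.h2 U lam β ζ ≤ c * g.cutH β ζ

/-- **TWO BLOCK-NORM MAJORANTS OF THE PRINTED SHAPES ⇒ THE (3.44) AND (3.45) LINES AS TYPED** (the second and third conjuncts of
`B9.Ineq343_345`): if for 0 < ε ≦ 1 the operator A read from `bH ε` into the sharp blocks of Y has the majorant B′(ε)e^{−δ₀d(y,y′)}, and
for 0 < ε ≦ 1, 0 ≦ β < 1 the operator Φ^Y_β∘A read from `bH (β+ε)` into the probe lattice has the majorant B′(ε,β)(L^jη)^{−β}e^{−δ₀d(y,y′)},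
then the (3.44) and (3.45) lines hold for K at U. [cite: Balaban1985BackgroundPropagators, (3.44)–(3.45) p.398] -/
theorem lines3445_of_hasMaj {K : B9.KernelFamily g B} {U : B.Cfg} {𝔭 : HolderProbes g B X Y PX PY}
    {bH : ℝ → BlockNorm (toB6 g R H) (Y → ℝ)} {blkY : Y → g.Site} {evY : g.Loc → Y → ℝ} {A : (Y → ℝ) →ₗ[ℝ] (Y → ℝ)}
    (hR : InputReads K U 𝔭 bH blkY evY A) {Bε : ℝ → ℝ} {Bεβ : ℝ → ℝ → ℝ} {δ₀ : ℝ}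
    (hBε : ∀ ε, 0 < ε → ε ≤ 1 → 0 ≤ Bε ε) (hBεβ : ∀ ε β, 0 < ε → ε ≤ 1 → 0 ≤ β → β < 1 → 0 ≤ Bεβ ε β)
    (hlen : ∀ y : g.Site, 0 < g.len y)
    (h44 : ∀ ε, 0 < ε → ε ≤ 1 → HasMaj (bH ε) (BlockNorm.ofBlocks (toB6 g R H) blkY) A
      (fun (a b : g.Site) => Bε ε * Real.exp (-(δ₀ * g.dist a b))))
    (h45 : ∀ ε β, 0 < ε → ε ≤ 1 → 0 ≤ β → β < 1 →
      HasMaj (bH (β + ε)) (BlockNorm.ofBlocks (toB6 g R H) 𝔭.blkPY) (𝔭.ΦY U β ∘ₗ A)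
        (fun (a b : g.Site) => Bεβ ε β * g.len a ^ (-β) * Real.exp (-(δ₀ * g.dist a b)))) :
    (∀ (ε : ℝ) (lam : g.Loc) (y y' : g.Site), 0 < ε → ε ≤ 1 → g.suppInT lam y' →
        K.e4 U lam y ≤ Bε ε * Real.exp (-(δ₀ * g.dist y y')) * (g.holder ε lam + g.supNorm lam)) ∧
      (∀ (ε β : ℝ) (lam : g.Loc) (ζ : g.Cut) (y y' : g.Site), 0 < ε → ε ≤ 1 → 0 ≤ β → β < 1 →
        g.cutInT ζ y → g.suppInT lam y' →
        K.h2 U lam β ζ ≤ Bεβ ε β * (g.len y) ^ (-β) * g.cutH β ζ * Real.exp (-(δ₀ * g.dist y y')) *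
          (g.holder (β + ε) lam + g.supNorm lam)) := by
  refine ⟨fun ε lam y y' hε0 hε1 hs => ?_, fun ε β lam ζ y y' hε0 hε1 hβ0 hβ1 hζ hs => ?_⟩
  · have hK : 0 ≤ Bε ε * Real.exp (-(δ₀ * g.dist y y')) := mul_nonneg (hBε ε hε0 hε1) (Real.exp_nonneg _)
    have hc : 0 ≤ Bε ε * Real.exp (-(δ₀ * g.dist y y')) * (g.holder ε lam + g.supNorm lam) :=
      mul_nonneg hK (hR.hs_nonneg ε lam)
    refine hR.obs4 lam y _ hc fun v hv => ?_
    have hb := h44 ε hε0 hε1 y' (evY lam) (hR.isLoc ε lam y' hs) y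
    have hpt := abs_apply_le_ofBlocks_loc (G := toB6 g R H) blkY y (A (evY lam)) v hv
    exact hpt.trans (hb.trans (mul_le_mul_of_nonneg_left (hR.loc_le ε lam y' hs) hK))
  · have hK : 0 ≤ Bεβ ε β * g.len y ^ (-β) * Real.exp (-(δ₀ * g.dist y y')) :=
      mul_nonneg (mul_nonneg (hBεβ ε β hε0 hε1 hβ0 hβ1) (Real.rpow_nonneg (hlen y).le _)) (Real.exp_nonneg _)
    have hc : 0 ≤ Bεβ ε β * g.len y ^ (-β) * Real.exp (-(δ₀ * g.dist y y')) * (g.holder (β + ε) lam + g.supNorm lam) :=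
      mul_nonneg hK (hR.hs_nonneg (β + ε) lam)
    have hobs := hR.obs5 lam β ζ y _ hc hζ fun p hp => by
      have hb := h45 ε β hε0 hε1 hβ0 hβ1 y' (evY lam) (hR.isLoc (β + ε) lam y' hs) y
      have hpt := abs_apply_le_ofBlocks_loc (G := toB6 g R H) 𝔭.blkPY y ((𝔭.ΦY U β ∘ₗ A) (evY lam)) p hp
      rw [LinearMap.comp_apply] at hpt
      exact hpt.trans (hb.trans (mul_le_mul_of_nonneg_left (hR.loc_le (β + ε) lam y' hs) hK))
    exact hobs.trans (le_of_eq (by ring))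

end Readings

section Tail

variable {g : B9.Geometry} [Fintype g.Site] {R : ℝ} {H : Prop} {X Z : Type} [Fintype X] [Fintype Z]
variable {F₁ : Type} [AddCommGroup F₁] [Module ℝ F₁]

/-- The cutting cost of the sharp-block sup sizes is 1. [folklore] -/
private theorem ofBlocks_κ' (blk : X → g.Site) : (BlockNorm.ofBlocks (toB6 g R H) blk).κ = 1 := rfl

/-- **THE TAIL COMPOSITION** (the second summand of ∇_UG∇\*_U = ∇_UG₀∇\*_U + (∇_UG)(R∇\*_U)): a two-space sup ∕ probe majorant
C·(L^jη)^γ·L^jη·e^{−δd} of S (the sum read through ∇_U, or through Φ^Y_β∘∇_U) after an operator P from the input block norm `b₁` into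
the sharp blocks with the majorant θ·(L^jη)⁻¹·e^{−δ₁d} (the factors R∇\*_U summed, *"additional power of L^jη"*): S∘P has, from `b₁` into
the sharp blocks of Z, the majorant CθL₀c₁(α₁)·(L^jη)^γ·e^{−(1−α)δd(y,y′)} — `B11SectG.hasMaj_comp`, p. 398's transfer L^jη(L^{j″}η)⁻¹
e^{−αδd(y,y″)} ≦ L₀ ((2.60)) and [4] (2.61) at (δ₁, α₁) for (1 − α)δ ≦ (1 − α₁)δ₁ (`conv_exp_le_of_261`).
[cite: Balaban1985BackgroundPropagators, (3.106) p.414 + p.413 + p.398; Balaban1984PropagatorsII, (2.52)–(2.55) p.232 + Lemma 2.1 (2.60)–(2.61) p.234] -/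
theorem tail_comp (b₁ : BlockNorm (toB6 g R H) F₁) (blk : X → g.Site) (blkZ : Z → g.Site) {S : (X → ℝ) →ₗ[ℝ] (Z → ℝ)}
    {P : F₁ →ₗ[ℝ] (X → ℝ)} {d d₁ : ℕ} {δ α L₀ δ₁ α₁ C θ γ : ℝ} (hF : Facts347 g R H d δ α L₀)
    (h261 : Ineq261 d₁ (toB6 g R H) δ₁ α₁) (htri : Triangle254 (toB6 g R H))
    (hsymm : ∀ y y' : g.Site, g.dist y y' = g.dist y' y) (hdnn : ∀ y y' : g.Site, 0 ≤ g.dist y y')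
    (hlen : ∀ y : g.Site, 0 < g.len y) (hC : 0 ≤ C) (hθ : 0 ≤ θ) (hαδ1 : α * δ ≤ δ)
    (hrate : (1 - α) * δ ≤ (1 - α₁) * δ₁)
    (hS : HasMajorantHom (g := toB6 g R H) blk blkZ S
      (fun (a b : g.Site) => C * (g.len a ^ γ * g.len a) * Real.exp (-(δ * g.dist a b))))
    (hP : HasMaj b₁ (BlockNorm.ofBlocks (toB6 g R H) blk) P
      (fun (y y' : g.Site) => θ * (g.len y)⁻¹ * Real.exp (-(δ₁ * g.dist y y')))) :
    HasMaj b₁ (BlockNorm.ofBlocks (toB6 g R H) blkZ) (S ∘ₗ P)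
      (fun (a b : g.Site) => C * θ * L₀ * B6.c1 d₁ δ₁ α₁ * g.len a ^ γ * Real.exp (-((1 - α) * δ * g.dist a b))) := by
  have hlen0 : ∀ y : g.Site, 0 ≤ g.len y := fun y => (hlen y).le
  have hL₀ : 0 ≤ L₀ := le_trans (le_trans zero_le_one hF.one_le_L) hF.L_le
  have hK : ∀ a b : g.Site, 0 ≤ C * (g.len a ^ γ * g.len a) * Real.exp (-(δ * g.dist a b)) := fun a b =>
    mul_nonneg (mul_nonneg hC (mul_nonneg (Real.rpow_nonneg (hlen0 a) _) (hlen0 a))) (Real.exp_nonneg _)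
  have hS' := hasMaj_of_hasMajorantHom (G := toB6 g R H) blk blkZ hK hS
  have hcomp := hasMaj_comp hS' hP hK
  refine hcomp.mono fun a b => ?_
  rw [ofBlocks_κ']
  -- the transfer: L^jη (L^{j″}η)⁻¹ e^{−δd(y,y″)} ≤ L₀ e^{−(1−α)δd(y,y″)}
  have htransfer : ∀ z : g.Site, g.len a * (g.len z)⁻¹ * Real.exp (-(δ * g.dist a z)) ≤
      L₀ * Real.exp (-((1 - α) * δ * g.dist a z)) := by
    intro z
    have hst : Real.exp (-(α * δ * g.dist a z)) * g.len z ^ (-1 : ℝ) ≤ g.L ^ |(-1 : ℝ)| * g.len a ^ (-1 : ℝ) :=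
      scaleTransfer_len_rpow hF (-1) (by norm_num) a z
    rw [Real.rpow_neg_one, Real.rpow_neg_one, abs_neg, abs_one, Real.rpow_one] at hst
    have hsplit : Real.exp (-(δ * g.dist a z)) = Real.exp (-(α * δ * g.dist a z)) * Real.exp (-((1 - α) * δ * g.dist a z)) := by
      rw [← Real.exp_add]; congr 1; ring
    have hkey : g.len a * (g.len z)⁻¹ * Real.exp (-(α * δ * g.dist a z)) ≤ L₀ := by
      have h1 : g.len a * (Real.exp (-(α * δ * g.dist a z)) * (g.len z)⁻¹) ≤ g.len a * (g.L * (g.len a)⁻¹) :=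
        mul_le_mul_of_nonneg_left hst (hlen0 a)
      have h2 : g.len a * (g.L * (g.len a)⁻¹) = g.L := by
        rw [mul_comm g.L, ← mul_assoc, mul_inv_cancel₀ (hlen a).ne', one_mul]
      calc g.len a * (g.len z)⁻¹ * Real.exp (-(α * δ * g.dist a z))
          = g.len a * (Real.exp (-(α * δ * g.dist a z)) * (g.len z)⁻¹) := by ring
        _ ≤ g.L := by rw [← h2]; exact h1
        _ ≤ L₀ := hF.L_le
    rw [hsplit]
    calc g.len a * (g.len z)⁻¹ * (Real.exp (-(α * δ * g.dist a z)) * Real.exp (-((1 - α) * δ * g.dist a z)))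
        = (g.len a * (g.len z)⁻¹ * Real.exp (-(α * δ * g.dist a z))) * Real.exp (-((1 - α) * δ * g.dist a z)) := by ring
      _ ≤ L₀ * Real.exp (-((1 - α) * δ * g.dist a z)) := mul_le_mul_of_nonneg_right hkey (Real.exp_nonneg _)
  -- the convolution at (δ₁, α₁): Σ_z e^{−(1−α)δd(y,y″)} e^{−δ₁d(y″,y′)} ≤ c₁ e^{−(1−α)δd(y,y′)}
  have hδ' : 0 ≤ (1 - α) * δ := by nlinarith [hαδ1]
  have hconv : ∑ z : g.Site, Real.exp (-((1 - α) * δ * g.dist a z)) * Real.exp (-(δ₁ * g.dist z b)) ≤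
      B6.c1 d₁ δ₁ α₁ * Real.exp (-((1 - α) * δ * g.dist a b)) := by
    have h := conv_exp_le_of_261 (R := R) (H := H) d₁ δ₁ α₁ ((1 - α) * δ) hδ' hrate htri hdnn h261 b a
    have hrw : ∀ z : g.Site, Real.exp (-((1 - α) * δ * g.dist a z)) * Real.exp (-(δ₁ * g.dist z b)) =
        Real.exp (-(δ₁ * g.dist b z)) * Real.exp (-((1 - α) * δ * g.dist z a)) := by
      intro z; rw [hsymm a z, hsymm z b, mul_comm]
    rw [Finset.sum_congr rfl fun z _ => hrw z, hsymm a b]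
    exact h
  have hγ0 : 0 ≤ g.len a ^ γ := Real.rpow_nonneg (hlen0 a) _
  calc (∑ z : g.Site, C * (g.len a ^ γ * g.len a) * Real.exp (-(δ * (toB6 g R H).dist a z)) *
          (1 * (θ * (g.len z)⁻¹ * Real.exp (-(δ₁ * (toB6 g R H).dist z b)))))
      = C * θ * g.len a ^ γ * ∑ z : g.Site, (g.len a * (g.len z)⁻¹ * Real.exp (-(δ * g.dist a z))) *
          Real.exp (-(δ₁ * g.dist z b)) := by
        simp only [toB6_dist]
        rw [Finset.mul_sum]
        exact Finset.sum_congr rfl fun z _ => by ring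
    _ ≤ C * θ * g.len a ^ γ * ∑ z : g.Site, (L₀ * Real.exp (-((1 - α) * δ * g.dist a z))) *
          Real.exp (-(δ₁ * g.dist z b)) := by
        refine mul_le_mul_of_nonneg_left (Finset.sum_le_sum fun z _ => ?_) (mul_nonneg (mul_nonneg hC hθ) hγ0)
        exact mul_le_mul_of_nonneg_right (htransfer z) (Real.exp_nonneg _)
    _ = C * θ * L₀ * g.len a ^ γ * ∑ z : g.Site, Real.exp (-((1 - α) * δ * g.dist a z)) * Real.exp (-(δ₁ * g.dist z b)) := by
        rw [Finset.mul_sum, Finset.mul_sum]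
        exact Finset.sum_congr rfl fun z _ => by ring
    _ ≤ C * θ * L₀ * g.len a ^ γ * (B6.c1 d₁ δ₁ α₁ * Real.exp (-((1 - α) * δ * g.dist a b))) :=
        mul_le_mul_of_nonneg_left hconv (mul_nonneg (mul_nonneg (mul_nonneg hC hθ) hL₀) hγ0)
    _ = C * θ * L₀ * B6.c1 d₁ δ₁ α₁ * g.len a ^ γ * Real.exp (-((1 - α) * δ * g.dist a b)) := by ring

omit [Fintype X] [Fintype Z] in
/-- Algebra of (3.106) read through a left member E and the right letter ∇\*_U: G = G₀ + GR ⇒ E∘G∘∇\* = E∘G₀∘∇\* + (E∘G)∘(R∘∇\*).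
[folklore] -/
private theorem twoSided_split {Y' : Type} {E : (X → ℝ) →ₗ[ℝ] (Z → ℝ)} {Dst : (Y' → ℝ) →ₗ[ℝ] (X → ℝ)}
    {G G0 W : Module.End ℝ (X → ℝ)} (h : G = G0 + G * W) :
    E ∘ₗ (G ∘ₗ Dst) = E ∘ₗ (G0 ∘ₗ Dst) + (E ∘ₗ G) ∘ₗ (W ∘ₗ Dst) := by
  conv_lhs => rw [h]
  apply LinearMap.ext
  intro μ
  simp only [LinearMap.comp_apply, LinearMap.add_apply, Module.End.mul_apply, map_add]

end Tail

/-! ## §2 The sum G(U) of (3.107): the input legs, the factors' input bounds, (3.44)–(3.45) at one member, and the leaf -/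

section GSide

variable {g : B9.Geometry} [Fintype g.Site] [DecidableEq g.Site] {R : ℝ} {H : Prop} {B : B9.Backgrounds}
variable {X Y ι A PX PY : Type}

/-- **COROLLARY 3.6's INPUT-SIDE HÖLDER MEMBERS (3.44), (3.45) FOR THE HEAD TERMS h_□G_□(U)h_□ OF (3.107), LOCALIZED** (p. 409: the
G_□(U) *"satisfy all the inequalities of Theorems 3.1–3.3"*): for 0 < ε ≦ 1 the two-sided head term ∇_U(h_□G_□h_□)∇\*_U read from the
input block norm `bH ε` into the sharp blocks of Y has the majorant 1_{S_I(□)}(y)·B_I(ε)·e^{−δ₀d(y,y′)}; and for 0 ≦ β < 1 the same term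
read through the probes Φ^Y_β from `bH (β+ε)` has 1_{S_I(□)}(y)·B_I(ε,β)·(L^jη)^{−β}e^{−δ₀d(y,y′)}.  POSITED AS A WHOLE (incl. the product
rules through h_□ and the sizes (3.100)); a HYPOTHESIS SCHEMA, Corollary 3.6 is not asserted.
[cite: Balaban1985BackgroundPropagators, Cor. 3.6 p.408 + (3.44)–(3.45) p.398 + (3.100) p.413] -/
structure InputLegs310 [Fintype Y] [Fintype PY] (𝔬 : Ops310 g B X Y ι A) (𝔭 : HolderProbes g B X Y PX PY) (R : ℝ) (H : Prop)
    (bH : ℝ → BlockNorm (toB6 g R H) (Y → ℝ)) (SI : ι → Finset g.Site) (BI : ℝ → ℝ) (BI2 : ℝ → ℝ → ℝ) (δ₀ : ℝ)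
    (U : B.Cfg) : Prop where
  e4 : ∀ ε : ℝ, 0 < ε → ε ≤ 1 → ∀ i, HasMaj (bH ε) (BlockNorm.ofBlocks (toB6 g R H) 𝔬.blkY)
    (𝔬.D U ∘ₗ ((mulOp (𝔬.h i) * 𝔬.Gsq U i * mulOp (𝔬.h i)) ∘ₗ 𝔬.Dstar U))
    (fun (a b : g.Site) => (if a ∈ SI i then (1 : ℝ) else 0) * (BI ε * Real.exp (-(δ₀ * g.dist a b))))
  h2 : ∀ ε β : ℝ, 0 < ε → ε ≤ 1 → 0 ≤ β → β < 1 → ∀ i, HasMaj (bH (β + ε)) (BlockNorm.ofBlocks (toB6 g R H) 𝔭.blkPY)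
    ((𝔭.ΦY U β ∘ₗ 𝔬.D U) ∘ₗ ((mulOp (𝔬.h i) * 𝔬.Gsq U i * mulOp (𝔬.h i)) ∘ₗ 𝔬.Dstar U))
    (fun (a b : g.Site) => (if a ∈ SI i then (1 : ℝ) else 0) * (BI2 ε β * g.len a ^ (-β) * Real.exp (-(δ₀ * g.dist a b))))

/-- **THE FACTORS R_a(U)∇\*_U FROM THE INPUT HÖLDER NORM** (p. 413: *"a bound of the type (3.89), possibly with an additional power of
L^jη"*; p. 398: *"we may always replace ∇_U by ∇\*_U … in arbitrary place and combination"*): for every ε > 0, R_a∇\*_U read from `bH ε`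
into the sharp blocks has the majorant 1_{X∩𝔅}(y)·θ_I(ε)M⁻¹·(L^jη)⁻¹·e^{−δ₀d(y,y′)}.  POSITED; a HYPOTHESIS SCHEMA.
[cite: Balaban1985BackgroundPropagators, p.413 + (3.105) p.414 + (3.89) p.409 + p.398] -/
structure FactorsInput310 [Fintype X] [Fintype Y] (𝔬 : Ops310 g B X Y ι A) (R : ℝ) (H : Prop) (bH : ℝ → BlockNorm (toB6 g R H) (Y → ℝ))
    (θI : ℝ → ℝ) (δ₀ : ℝ) (U : B.Cfg) : Prop where
  facD : ∀ ε : ℝ, 0 < ε → ∀ a : A, HasMaj (bH ε) (BlockNorm.ofBlocks (toB6 g R H) 𝔬.blk) (𝔬.Rf U a ∘ₗ 𝔬.Dstar U)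
    (fun (y y' : g.Site) => (if y ∈ 𝔬.SF a then (1 : ℝ) else 0) *
      (θI ε * g.M⁻¹ * (g.len y)⁻¹ * Real.exp (-(δ₀ * g.dist y y'))))

/-- **The constant of the (3.44) member of the sum** at ε: N_I·B_I(ε) (head legs summed) + C·N_F·θ_I(ε)·L₀·c₁(α₁) (the sup constant C of
∇_UG, the factors' input bounds summed, the transfer, one convolution). [cite: Balaban1985BackgroundPropagators, (3.44) p.398 + Thm 3.10 p.416] -/
def inputConst44 (d₁ : ℕ) (δ₁ α₁ NI NF C L₀ b t : ℝ) : ℝ :=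
  NI * b + C * (NF * t) * L₀ * B6.c1 d₁ δ₁ α₁

/-- **The constant of the (3.45) member of the sum** at (ε, β): N_I·B_I(ε,β) + (Hölder constant of Φ^Y_β∘∇_UG)·N_F·θ_I(β+ε)·L₀·c₁(α₁).
[cite: Balaban1985BackgroundPropagators, (3.45) p.398 + Thm 3.10 p.416] -/
def inputConst45 (d₁ : ℕ) (δ₁ α₁ NI NF L₀ hc b t : ℝ) : ℝ :=
  NI * b + hc * (NF * t) * L₀ * B6.c1 d₁ δ₁ α₁

/-- The factors R_a∇\*_U summed with the overlap count N_F. [cite: Balaban1985BackgroundPropagators, p.413] -/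
private theorem factorsInput_sum [Fintype Y] [Fintype X] [Fintype A] {𝔬 : Ops310 g B X Y ι A}
    {bH : ℝ → BlockNorm (toB6 g R H) (Y → ℝ)} {θI : ℝ → ℝ} {δ₀ : ℝ} {U : B.Cfg} {NF ε : ℝ}
    (hFI : FactorsInput310 𝔬 R H bH θI δ₀ U) (hε : 0 < ε) (hθ : 0 ≤ θI ε * g.M⁻¹) (hlen : ∀ y : g.Site, 0 ≤ g.len y)
    (hcntF : ∀ a : g.Site, (∑ q, if a ∈ 𝔬.SF q then (1 : ℝ) else 0) ≤ NF) :
    HasMaj (bH ε) (BlockNorm.ofBlocks (toB6 g R H) 𝔬.blk) ((∑ a, 𝔬.Rf U a) ∘ₗ 𝔬.Dstar U)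
      (fun (y y' : g.Site) => NF * (θI ε * g.M⁻¹) * (g.len y)⁻¹ * Real.exp (-(δ₀ * g.dist y y'))) := by
  have hsum : (∑ a, 𝔬.Rf U a) ∘ₗ 𝔬.Dstar U = ∑ a, 𝔬.Rf U a ∘ₗ 𝔬.Dstar U := by
    apply LinearMap.ext
    intro μ
    simp only [LinearMap.comp_apply, LinearMap.sum_apply]
  rw [hsum]
  have h := hasMaj_localSum (G := toB6 g R H) (fun a => 𝔬.Rf U a ∘ₗ 𝔬.Dstar U)
    (fun a (y : g.Site) => if y ∈ 𝔬.SF a then (1 : ℝ) else 0)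
    (fun (y y' : g.Site) => θI ε * g.M⁻¹ * (g.len y)⁻¹ * Real.exp (-(δ₀ * g.dist y y'))) NF
    (fun y y' => mul_nonneg (mul_nonneg hθ (inv_nonneg.mpr (hlen y))) (Real.exp_nonneg _)) (hFI.facD ε hε) hcntF
  exact h.mono fun y y' => le_of_eq (by ring)

/-- **THE INPUT-SIDE HÖLDER MEMBERS (3.44), (3.45) OF THE SUM G(U) OF (3.107) AT ONE MEMBER AND ONE CONFIGURATION U** — both block-norm
majorants, from: (3.106) (G = G₀ + GR, `B9Thm37Sum.fixedPoint_of_388`) read as ∇_UG∇\*_U = ∇_UG₀∇\*_U + (∇_UG)(R∇\*_U) and its probe twin;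
the input legs (`InputLegs310`) summed with N_I; the sup majorant C·L^jη·e^{−δd} of ∇_UG (the pin, third datum) resp. the probe majorant
of Φ^Y_β∘∇_UG (`B9RWSums343Holder.holder343_of_local310`, whose inputs are therefore inputs here); the factors' input bounds (`FactorsInput310`)
summed with N_F; and `tail_comp`.  For 0 < ε ≦ 1 (and 0 ≦ β < 1): ∇_UG∇\*_U : b_H(ε) → sharp blocks has majorant `inputConst44 …`(ε)·
e^{−(1−α)δd}, and Φ^Y_β∘∇_UG∇\*_U : b_H(β+ε) → probes has `inputConst45 …`(ε,β)·(L^jη)^{−β}e^{−(1−α)δd}.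
[cite: Balaban1985BackgroundPropagators, Thm 3.10 (3.105)–(3.108) pp.414–416 + (3.44)–(3.45) p.398 + p.413; Balaban1984PropagatorsII, (2.52)–(2.55) p.232 + Lemma 2.1 p.234] -/
theorem input3445_of_local310 [Fintype X] [DecidableEq X] [Fintype Y] [DecidableEq Y] [Fintype ι] [Fintype A]
    [Fintype PX] [DecidableEq PX] [Fintype PY] [DecidableEq PY]
    (𝔬 : Ops310 g B X Y ι A) (𝔭 : HolderProbes g B X Y PX PY) (R : ℝ) (H : Prop) (bH : ℝ → BlockNorm (toB6 g R H) (Y → ℝ))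
    (d d₁ : ℕ) (δ α L₀ δ₁ α₁ ρ N N' NF Cℓ θ₀ NH NI C : ℝ) (κ : Sizes310) (SH SI : ι → Finset g.Site)
    (Bl θH BI θI : ℝ → ℝ) (BI2 : ℝ → ℝ → ℝ) (U : B.Cfg)
    (hδ₁ : 0 ≤ δ₁) (hα₁ : 0 ≤ α₁) (hα₁1 : α₁ ≤ 1) (hNF : 0 ≤ NF) (hθ₀ : 0 ≤ θ₀) (hNH : 0 ≤ NH) (hNI : 0 ≤ NI) (hM : 1 ≤ g.M)
    (hC : 0 ≤ C) (hδ : 0 ≤ δ) (hδle : δ ≤ (1 - α₁) * δ₁) (hαδ : 0 ≤ α * δ) (hαδ1 : α * δ ≤ δ)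
    (hs : StaticOK310 𝔬 ρ N N' NF Cℓ κ) (hcntH : ∀ a : g.Site, (∑ i, if a ∈ SH i then (1 : ℝ) else 0) ≤ NH)
    (hcntI : ∀ a : g.Site, (∑ i, if a ∈ SI i then (1 : ℝ) else 0) ≤ NI)
    (hBl : ∀ β, 0 ≤ β → β < 1 → 0 ≤ Bl β) (hθH : ∀ β, 0 ≤ β → β < 1 → 0 ≤ θH β)
    (hBI : ∀ ε, 0 < ε → ε ≤ 1 → 0 ≤ BI ε) (hBI2 : ∀ ε β, 0 < ε → ε ≤ 1 → 0 ≤ β → β < 1 → 0 ≤ BI2 ε β)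
    (hθI : ∀ ε, 0 < ε → 0 ≤ θI ε)
    (h261 : Ineq261 d₁ (toB6 g R H) δ₁ α₁) (hF : Facts347 g R H d δ α L₀)
    (hq : NF * (θ₀ * g.M⁻¹) * B6.c1 d₁ δ₁ α₁ ≤ 1 / 2)
    (hf : Factors389 𝔬 R H θ₀ δ₁ U) (hi : Identities310 𝔬 R H U)
    (hL : HolderLegs310 𝔬 𝔭 R H SH Bl δ₁ U) (hFH : FactorsHolder310 𝔬 𝔭 R H θH δ₁ U)
    (hIL : InputLegs310 𝔬 𝔭 R H bH SI BI BI2 δ₁ U) (hFI : FactorsInput310 𝔬 R H bH θI δ₁ U)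
    (h1 : HasMajorantHom (g := toB6 g R H) 𝔬.blk 𝔬.blkY (𝔬.D U ∘ₗ 𝔬.G U)
      (fun (a b : g.Site) => C * g.len a * Real.exp (-(δ * g.dist a b))))
    (h2 : HasMajorantHom (g := toB6 g R H) 𝔬.blkY 𝔬.blk (𝔬.G U ∘ₗ 𝔬.Dstar U)
      (fun (a b : g.Site) => C * g.len a * Real.exp (-(δ * g.dist a b)))) :
    (∀ ε : ℝ, 0 < ε → ε ≤ 1 → HasMaj (bH ε) (BlockNorm.ofBlocks (toB6 g R H) 𝔬.blkY) (𝔬.D U ∘ₗ (𝔬.G U ∘ₗ 𝔬.Dstar U))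
        (fun (a b : g.Site) => inputConst44 d₁ δ₁ α₁ NI NF C L₀ (BI ε) (θI ε) * Real.exp (-((1 - α) * δ * g.dist a b)))) ∧
      (∀ ε β : ℝ, 0 < ε → ε ≤ 1 → 0 ≤ β → β < 1 →
        HasMaj (bH (β + ε)) (BlockNorm.ofBlocks (toB6 g R H) 𝔭.blkPY) (𝔭.ΦY U β ∘ₗ (𝔬.D U ∘ₗ (𝔬.G U ∘ₗ 𝔬.Dstar U)))
          (fun (a b : g.Site) => inputConst45 d₁ δ₁ α₁ NI NF L₀ (holderConst d₁ δ₁ α₁ NH NF C (Bl β) (θH β)) (BI2 ε β)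
            (θI (β + ε)) * g.len a ^ (-β) * Real.exp (-((1 - α) * δ * g.dist a b)))) := by
  have hMpos : 0 < g.M := lt_of_lt_of_le one_pos hM
  have hMinv : g.M⁻¹ ≤ 1 := inv_le_one_of_one_le₀ hM
  have hMinv0 : 0 ≤ g.M⁻¹ := inv_nonneg.mpr hMpos.le
  have hlen0 : ∀ y : g.Site, 0 ≤ g.len y := fun y => (hs.lenpos y).le
  have htri : Triangle254 (toB6 g R H) := fun a b c => hs.tri a b c
  have hc1 : 0 ≤ B6.c1 d₁ δ₁ α₁ := c1_nonneg d₁ δ₁ α₁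
  have hL₀ : 0 ≤ L₀ := le_trans (le_trans zero_le_one hF.one_le_L) hF.L_le
  have hαδ₁ : 0 ≤ α₁ * δ₁ := mul_nonneg hα₁ hδ₁
  have hrate : (1 - α) * δ ≤ (1 - α₁) * δ₁ := by nlinarith [hαδ, hδle]
  have hexp : ∀ a b : g.Site, Real.exp (-(δ₁ * g.dist a b)) ≤ Real.exp (-((1 - α) * δ * g.dist a b)) := fun a b =>
    Real.exp_le_exp.mpr (neg_le_neg (mul_le_mul_of_nonneg_right (by nlinarith [hrate, hαδ₁]) (hs.dnn a b)))
  -- (3.106) and its reading through a left member and ∇*_U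
  have hfix : 𝔬.G U = (∑ i, mulOp (𝔬.h i) * 𝔬.Gsq U i * mulOp (𝔬.h i)) + 𝔬.G U * ∑ a, 𝔬.Rf U a :=
    fixedPoint_of_388 hi.inv hi.eq3105
  have hsumE : ∀ {Z : Type} (E : (X → ℝ) →ₗ[ℝ] (Z → ℝ)),
      E ∘ₗ ((∑ i, mulOp (𝔬.h i) * 𝔬.Gsq U i * mulOp (𝔬.h i)) ∘ₗ 𝔬.Dstar U) =
        ∑ i, E ∘ₗ ((mulOp (𝔬.h i) * 𝔬.Gsq U i * mulOp (𝔬.h i)) ∘ₗ 𝔬.Dstar U) := by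
    intro Z E
    apply LinearMap.ext
    intro μ
    simp only [LinearMap.comp_apply, LinearMap.sum_apply, map_sum]
  refine ⟨fun ε hε0 hε1 => ?_, fun ε β hε0 hε1 hβ0 hβ1 => ?_⟩
  · -- (3.44): ∇G∇* = ∇G₀∇* + (∇G)(R∇*)
    have hθ : 0 ≤ θI ε * g.M⁻¹ := mul_nonneg (hθI ε hε0) hMinv0
    have hP := factorsInput_sum hFI hε0 hθ hlen0 hs.cntF
    have hS : HasMajorantHom (g := toB6 g R H) 𝔬.blk 𝔬.blkY (𝔬.D U ∘ₗ 𝔬.G U)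
        (fun (a b : g.Site) => C * (g.len a ^ (0 : ℝ) * g.len a) * Real.exp (-(δ * g.dist a b))) :=
      hasMajorantHom_mono (g := toB6 g R H) 𝔬.blk 𝔬.blkY h1 fun a b => le_of_eq (by rw [Real.rpow_zero, one_mul])
    have htail := tail_comp (bH ε) 𝔬.blk 𝔬.blkY hF h261 htri hs.symm hs.dnn hs.lenpos hC (mul_nonneg hNF hθ) hαδ1 hrate hS hP
    have hhead := hasMaj_localSum (G := toB6 g R H)
      (fun i => 𝔬.D U ∘ₗ ((mulOp (𝔬.h i) * 𝔬.Gsq U i * mulOp (𝔬.h i)) ∘ₗ 𝔬.Dstar U))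
      (fun i (a : g.Site) => if a ∈ SI i then (1 : ℝ) else 0)
      (fun (a b : g.Site) => BI ε * Real.exp (-(δ₁ * g.dist a b))) NI
      (fun a b => mul_nonneg (hBI ε hε0 hε1) (Real.exp_nonneg _)) (hIL.e4 ε hε0 hε1) hcntI
    rw [twoSided_split hfix, hsumE]
    refine (hhead.add htail).mono fun a b => ?_
    have hK0 : 0 ≤ NI * BI ε := mul_nonneg hNI (hBI ε hε0 hε1)
    have ht : C * (NF * (θI ε * g.M⁻¹)) * L₀ * B6.c1 d₁ δ₁ α₁ ≤ C * (NF * θI ε) * L₀ * B6.c1 d₁ δ₁ α₁ := by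
      have h3 : θI ε * g.M⁻¹ ≤ θI ε := by
        calc θI ε * g.M⁻¹ ≤ θI ε * 1 := mul_le_mul_of_nonneg_left hMinv (hθI ε hε0)
          _ = θI ε := mul_one _
      have h4 : C * (NF * (θI ε * g.M⁻¹)) ≤ C * (NF * θI ε) :=
        mul_le_mul_of_nonneg_left (mul_le_mul_of_nonneg_left h3 hNF) hC
      exact mul_le_mul_of_nonneg_right (mul_le_mul_of_nonneg_right h4 hL₀) hc1
    calc NI * (BI ε * Real.exp (-(δ₁ * g.dist a b))) +
          C * (NF * (θI ε * g.M⁻¹)) * L₀ * B6.c1 d₁ δ₁ α₁ * g.len a ^ (0 : ℝ) * Real.exp (-((1 - α) * δ * g.dist a b))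
        = NI * BI ε * Real.exp (-(δ₁ * g.dist a b)) +
          C * (NF * (θI ε * g.M⁻¹)) * L₀ * B6.c1 d₁ δ₁ α₁ * Real.exp (-((1 - α) * δ * g.dist a b)) := by
          rw [Real.rpow_zero]; ring
      _ ≤ NI * BI ε * Real.exp (-((1 - α) * δ * g.dist a b)) +
          C * (NF * θI ε) * L₀ * B6.c1 d₁ δ₁ α₁ * Real.exp (-((1 - α) * δ * g.dist a b)) :=
          add_le_add (mul_le_mul_of_nonneg_left (hexp a b) hK0) (mul_le_mul_of_nonneg_right ht (Real.exp_nonneg _))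
      _ = inputConst44 d₁ δ₁ α₁ NI NF C L₀ (BI ε) (θI ε) * Real.exp (-((1 - α) * δ * g.dist a b)) := by
          unfold inputConst44; ring
  · -- (3.45): Φ∇G∇* = Φ∇G₀∇* + (Φ∇G)(R∇*)
    have hβε : 0 < β + ε := by linarith
    have hθ : 0 ≤ θI (β + ε) * g.M⁻¹ := mul_nonneg (hθI (β + ε) hβε) hMinv0
    have hP := factorsInput_sum hFI hβε hθ hlen0 hs.cntF
    have hHol := (holder343_of_local310 𝔬 𝔭 R H d₁ δ₁ α₁ ρ N N' NF Cℓ θ₀ NH C δ κ SH Bl θH U hδ₁ hα₁ hα₁1 hNF hθ₀ hNH hM hC hδ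
      hδle hs hcntH hBl hθH h261 hq hf hi hL hFH h2 β hβ0 hβ1).1
    have hHK : 0 ≤ holderConst d₁ δ₁ α₁ NH NF C (Bl β) (θH β) := by
      have hb := hBl β hβ0 hβ1
      have ht := hθH β hβ0 hβ1
      unfold holderConst
      positivity
    have hS : HasMajorantHom (g := toB6 g R H) 𝔬.blk 𝔭.blkPY ((𝔭.ΦY U β ∘ₗ 𝔬.D U) ∘ₗ 𝔬.G U)
        (fun (a b : g.Site) => holderConst d₁ δ₁ α₁ NH NF C (Bl β) (θH β) * (g.len a ^ (-β) * g.len a) *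
          Real.exp (-(δ * g.dist a b))) := by
      refine hasMajorantHom_mono (g := toB6 g R H) 𝔬.blk 𝔭.blkPY hHol fun a b => le_of_eq ?_
      have hr : g.len a ^ (1 - β) = g.len a ^ (-β) * g.len a := by
        rw [show (1 - β : ℝ) = -β + 1 by ring, Real.rpow_add (hs.lenpos a), Real.rpow_one]
      rw [hr]
    have htail := tail_comp (bH (β + ε)) 𝔬.blk 𝔭.blkPY hF h261 htri hs.symm hs.dnn hs.lenpos hHK (mul_nonneg hNF hθ) hαδ1
      hrate hS hP
    have hhead := hasMaj_localSum (G := toB6 g R H)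
      (fun i => (𝔭.ΦY U β ∘ₗ 𝔬.D U) ∘ₗ ((mulOp (𝔬.h i) * 𝔬.Gsq U i * mulOp (𝔬.h i)) ∘ₗ 𝔬.Dstar U))
      (fun i (a : g.Site) => if a ∈ SI i then (1 : ℝ) else 0)
      (fun (a b : g.Site) => BI2 ε β * g.len a ^ (-β) * Real.exp (-(δ₁ * g.dist a b))) NI
      (fun a b => mul_nonneg (mul_nonneg (hBI2 ε β hε0 hε1 hβ0 hβ1) (Real.rpow_nonneg (hlen0 a) _)) (Real.exp_nonneg _))
      (hIL.h2 ε β hε0 hε1 hβ0 hβ1) hcntI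
    have hassoc : 𝔭.ΦY U β ∘ₗ (𝔬.D U ∘ₗ (𝔬.G U ∘ₗ 𝔬.Dstar U)) = (𝔭.ΦY U β ∘ₗ 𝔬.D U) ∘ₗ (𝔬.G U ∘ₗ 𝔬.Dstar U) := by
      rw [LinearMap.comp_assoc]
    rw [hassoc, twoSided_split hfix, hsumE]
    refine (hhead.add htail).mono fun a b => ?_
    have hW : 0 ≤ g.len a ^ (-β) := Real.rpow_nonneg (hlen0 a) _
    have hK0 : 0 ≤ NI * BI2 ε β * g.len a ^ (-β) := mul_nonneg (mul_nonneg hNI (hBI2 ε β hε0 hε1 hβ0 hβ1)) hW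
    have ht : holderConst d₁ δ₁ α₁ NH NF C (Bl β) (θH β) * (NF * (θI (β + ε) * g.M⁻¹)) * L₀ * B6.c1 d₁ δ₁ α₁ ≤
        holderConst d₁ δ₁ α₁ NH NF C (Bl β) (θH β) * (NF * θI (β + ε)) * L₀ * B6.c1 d₁ δ₁ α₁ := by
      have h3 : θI (β + ε) * g.M⁻¹ ≤ θI (β + ε) := by
        calc θI (β + ε) * g.M⁻¹ ≤ θI (β + ε) * 1 := mul_le_mul_of_nonneg_left hMinv (hθI (β + ε) hβε)
          _ = θI (β + ε) := mul_one _
      have h4 : holderConst d₁ δ₁ α₁ NH NF C (Bl β) (θH β) * (NF * (θI (β + ε) * g.M⁻¹)) ≤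
          holderConst d₁ δ₁ α₁ NH NF C (Bl β) (θH β) * (NF * θI (β + ε)) :=
        mul_le_mul_of_nonneg_left (mul_le_mul_of_nonneg_left h3 hNF) hHK
      exact mul_le_mul_of_nonneg_right (mul_le_mul_of_nonneg_right h4 hL₀) hc1
    calc NI * (BI2 ε β * g.len a ^ (-β) * Real.exp (-(δ₁ * g.dist a b))) +
          holderConst d₁ δ₁ α₁ NH NF C (Bl β) (θH β) * (NF * (θI (β + ε) * g.M⁻¹)) * L₀ * B6.c1 d₁ δ₁ α₁ * g.len a ^ (-β) *
            Real.exp (-((1 - α) * δ * g.dist a b))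
        = NI * BI2 ε β * g.len a ^ (-β) * Real.exp (-(δ₁ * g.dist a b)) +
          holderConst d₁ δ₁ α₁ NH NF C (Bl β) (θH β) * (NF * (θI (β + ε) * g.M⁻¹)) * L₀ * B6.c1 d₁ δ₁ α₁ *
            (g.len a ^ (-β) * Real.exp (-((1 - α) * δ * g.dist a b))) := by ring
      _ ≤ NI * BI2 ε β * g.len a ^ (-β) * Real.exp (-((1 - α) * δ * g.dist a b)) +
          holderConst d₁ δ₁ α₁ NH NF C (Bl β) (θH β) * (NF * θI (β + ε)) * L₀ * B6.c1 d₁ δ₁ α₁ *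
            (g.len a ^ (-β) * Real.exp (-((1 - α) * δ * g.dist a b))) :=
          add_le_add (mul_le_mul_of_nonneg_left (hexp a b) hK0)
            (mul_le_mul_of_nonneg_right ht (mul_nonneg hW (Real.exp_nonneg _)))
      _ = inputConst45 d₁ δ₁ α₁ NI NF L₀ (holderConst d₁ δ₁ α₁ NH NF C (Bl β) (θH β)) (BI2 ε β) (θI (β + ε)) *
            g.len a ^ (-β) * Real.exp (-((1 - α) * δ * g.dist a b)) := by
          unfold inputConst45; ring

omit [Fintype g.Site] [DecidableEq g.Site] in
/-- Arithmetic of «for M sufficiently large»: M ≧ 2N_Fθ₀c₁ gives N_F·θ₀M⁻¹·c₁ ≦ ½. [folklore] -/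
private theorem small_of_threshold₃ {NF θ₀ c M : ℝ} (hM : 0 < M) (hbig : 2 * NF * θ₀ * c ≤ M) :
    NF * (θ₀ * M⁻¹) * c ≤ 1 / 2 := by
  have h1 : NF * (θ₀ * M⁻¹) * c = (NF * θ₀ * c) / M := by
    rw [div_eq_mul_inv]
    ring
  rw [h1, div_le_iff₀ hM]
  linarith

end GSide

section AllPinsG

variable {I : Type} {c35 : ℝ} {geo : I → B9.Geometry} {bg : I → B9.Backgrounds}
variable [∀ i, Fintype (geo i).Site] [∀ i, DecidableEq (geo i).Site]

/-- ★ **THEOREM 3.10 AT THE ALL-BLOCKS PIN WITH EVERY MEMBER OF THEOREM 3.3 PROVED INSIDE EXCEPT THE L² LINE n = 4** — the sibling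
`B9RWSums346Lap.thm310Printed_allPin_schur_holder_lap` with its (3.44), (3.45) conjuncts SUPPLIED: the displayed residual is the single
two-sided L² line ‖h∇_UG∇\*_UJ‖ (`hrest`).  Inputs beyond the sibling's: the input block-norm letters `bH i ε` with the co-reading
`InputReads` of `(K i).e4`, `(K i).h2` by ∇_UG(U)∇\*_U; per member and per U under Corollary 3.6's provisos the input legs and the
factors' input bounds (`InputLegs310`, `FactorsInput310`, overlap count N_I); the pin's α with αδ ≦ δ; and the family's constants
B′₀(ε) ≧ `inputConst44 …`(ε), B′₀(ε,β) ≧ `inputConst45 …`(ε,β).  Nothing of print asserted; NOT a node discharge.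
[cite: Balaban1985BackgroundPropagators, Thm 3.10 (3.105)–(3.108) pp.414–416 + Thm 3.3 p.399 + (3.42)–(3.47) pp.397–398 + Cor. 3.6 p.408; Balaban1984PropagatorsII, Lemma 2.1 (2.60)–(2.61) p.234] -/
theorem thm310Printed_allPin_inputHolder {X Y ι A PX PY : I → Type} [∀ i, Fintype (X i)] [∀ i, DecidableEq (X i)]
    [∀ i, Fintype (Y i)] [∀ i, DecidableEq (Y i)] [∀ i, Fintype (ι i)] [∀ i, Fintype (A i)] [∀ i, Fintype (PX i)]
    [∀ i, DecidableEq (PX i)] [∀ i, Fintype (PY i)] [∀ i, DecidableEq (PY i)]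
    {𝔬 : ∀ i, Ops310 (geo i) (bg i) (X i) (Y i) (ι i) (A i)}
    {rd : ∀ i, WalkReading310 (geo i) (bg i) (X i) (ι i) (A i)} {R : I → ℝ} {H : I → Prop} {C δ : ℝ}
    (𝔭 : ∀ i, HolderProbes (geo i) (bg i) (X i) (Y i) (PX i) (PY i))
    (bH : ∀ i, ℝ → BlockNorm (toB6 (geo i) (R i) (H i)) (Y i → ℝ))
    (K : ∀ i, B9.KernelFamily (geo i) (bg i)) (ev : ∀ i, (geo i).Loc → X i → ℝ) (evY : ∀ i, (geo i).Loc → Y i → ℝ)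
    {d : ℕ} {α L₀ B₀ δ₀ Mg Mr ar : ℝ} {Bβ Bε : ℝ → ℝ} {Bεβ : ℝ → ℝ → ℝ}
    (κ : I → Sizes310) (SH : ∀ i, ι i → Finset (geo i).Site) (Bl θH : ℝ → ℝ) (d₁ : ℕ)
    (δ₁ α₁ ρ N N' NF Cℓ θ₀ NH a₁ M₁ ML : ℝ)
    (SL : ∀ i, ι i → Finset (geo i).Site) (NL BL MF : ℝ) (d₁' : ℕ)
    (SI : ∀ i, ι i → Finset (geo i).Site) (NI : ℝ) (BI θI : ℝ → ℝ) (BI2 : ℝ → ℝ → ℝ)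
    (h310 : B9.Thm310Printed c35 geo bg (fun i => W310OfOps (𝔬 i) (rd i) (Conv3107 (𝔬 i) (R i) (H i) C δ)))
    (hco0 : ∀ i U, CoRealizes (K i) 0 U (𝔬 i).blk (𝔬 i).blk (ev i) ((𝔬 i).G U))
    (hco1 : ∀ i U, CoRealizes (K i) 1 U (𝔬 i).blkY (𝔬 i).blk (ev i) ((𝔬 i).D U ∘ₗ (𝔬 i).G U))
    (hco2 : ∀ i U, CoRealizes (K i) 2 U (𝔬 i).blk (𝔬 i).blkY (evY i) ((𝔬 i).G U ∘ₗ (𝔬 i).Dstar U))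
    (hco3 : ∀ i U, CoRealizes (K i) 3 U (𝔬 i).blk (𝔬 i).blk (ev i) ((𝔬 i).Lap U ∘ₗ (𝔬 i).G U))
    (hgl0 : ∀ i U, GlobReads (K i) 0 U (𝔬 i).blk (𝔬 i).blk (ev i) ((𝔬 i).G U))
    (hgl1 : ∀ i U, GlobReads (K i) 1 U (𝔬 i).blkY (𝔬 i).blk (ev i) ((𝔬 i).D U ∘ₗ (𝔬 i).G U))
    (hgl2 : ∀ i U, GlobReads (K i) 2 U (𝔬 i).blk (𝔬 i).blkY (evY i) ((𝔬 i).G U ∘ₗ (𝔬 i).Dstar U))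
    (hgl3 : ∀ i U, GlobReads (K i) 3 U (𝔬 i).blk (𝔬 i).blk (ev i) ((𝔬 i).Lap U ∘ₗ (𝔬 i).G U))
    (hl0 : ∀ i U, L2Reads (R := R i) (H := H i) (K i) 0 U (𝔬 i).blk (𝔬 i).blk (ev i) ((𝔬 i).G U))
    (hl1 : ∀ i U, L2Reads (R := R i) (H := H i) (K i) 1 U (𝔬 i).blkY (𝔬 i).blk (ev i) ((𝔬 i).D U ∘ₗ (𝔬 i).G U))
    (hl2 : ∀ i U, L2Reads (R := R i) (H := H i) (K i) 2 U (𝔬 i).blk (𝔬 i).blkY (evY i) ((𝔬 i).G U ∘ₗ (𝔬 i).Dstar U))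
    (hl3 : ∀ i U, L2Reads (R := R i) (H := H i) (K i) 3 U (𝔬 i).blk (𝔬 i).blk (ev i) ((𝔬 i).Lap U ∘ₗ (𝔬 i).G U))
    (hl5 : ∀ i U, L2Reads (R := R i) (H := H i) (K i) 5 U (𝔬 i).blk (𝔬 i).blk (ev i) ((𝔬 i).G U ∘ₗ (𝔬 i).Lap U))
    (hH1 : ∀ i U, H1Reads (K i) U (𝔭 i) (𝔬 i).blk (𝔬 i).blkY (ev i) (evY i) ((𝔬 i).D U ∘ₗ (𝔬 i).G U)
      ((𝔬 i).G U ∘ₗ (𝔬 i).Dstar U))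
    (hIR : ∀ i U, InputReads (K i) U (𝔭 i) (bH i) (𝔬 i).blkY (evY i) ((𝔬 i).D U ∘ₗ ((𝔬 i).G U ∘ₗ (𝔬 i).Dstar U)))
    (hsym : ∀ i U, IsTransposePair ((𝔬 i).G U) ((𝔬 i).G U))
    (htr : ∀ i U, IsTransposePair ((𝔬 i).D U ∘ₗ (𝔬 i).G U) ((𝔬 i).G U ∘ₗ (𝔬 i).Dstar U))
    (hadjL : ∀ i U, IsTransposePair ((𝔬 i).Lap U ∘ₗ (𝔬 i).G U) ((𝔬 i).G U ∘ₗ (𝔬 i).Lap U))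
    (hfacts : ∀ i, Mg ≤ (geo i).M → Facts347 (geo i) (R i) (H i) d δ α L₀)
    (hdsymm : ∀ i (a b : (geo i).Site), (geo i).dist a b = (geo i).dist b a)
    (hC : 0 ≤ C) (hCB : C ≤ B₀) (hCL : C * L₀ ≤ B₀) (hδ₀ : δ₀ ≤ (1 - α) * δ) (hα : 0 ≤ α * δ) (hαδ1 : α * δ ≤ δ)
    (hCg : C * B6.c1 d δ (1 - α) * L₀ ^ (4 : ℝ) ≤ B₀) (har : 0 < ar)
    (hc : 0 < c35) (ha₁ : 0 < a₁) (hα₁ : 0 ≤ α₁) (hα₁2 : α₁ ≤ 1 / 2) (hNF : 0 ≤ NF) (hθ₀ : 0 ≤ θ₀) (hNH : 0 ≤ NH)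
    (hδnn : 0 ≤ δ) (hδ5 : δ ≤ (1 - 2 * α₁) * δ₁) (hδ₁ : 0 ≤ δ₁) (hNL : 0 ≤ NL) (hBL : 0 ≤ BL) (hNI : 0 ≤ NI)
    (hB5 : Real.sqrt (C * lapConst d₁ δ₁ α₁ NL BL L₀) * L₀ ≤ B₀)
    (hst : ∀ i, StaticOK310 (𝔬 i) ρ N N' NF Cℓ (κ i))
    (hcntH : ∀ i (a : (geo i).Site), (∑ q, if a ∈ SH i q then (1 : ℝ) else 0) ≤ NH)
    (hcntL : ∀ i (a : (geo i).Site), (∑ q, if a ∈ SL i q then (1 : ℝ) else 0) ≤ NL)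
    (hcntI : ∀ i (a : (geo i).Site), (∑ q, if a ∈ SI i q then (1 : ℝ) else 0) ≤ NI)
    (hBl : ∀ β, 0 ≤ β → β < 1 → 0 ≤ Bl β) (hθH : ∀ β, 0 ≤ β → β < 1 → 0 ≤ θH β)
    (hBI : ∀ ε, 0 < ε → ε ≤ 1 → 0 ≤ BI ε) (hBI2 : ∀ ε β, 0 < ε → ε ≤ 1 → 0 ≤ β → β < 1 → 0 ≤ BI2 ε β)
    (hθI : ∀ ε, 0 < ε → 0 ≤ θI ε)
    (hBβ : ∀ β, 0 ≤ β → β < 1 → holderConst d₁ δ₁ α₁ NH NF C (Bl β) (θH β) ≤ Bβ β)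
    (hBε : ∀ ε, 0 < ε → ε ≤ 1 → inputConst44 d₁ δ₁ α₁ NI NF C L₀ (BI ε) (θI ε) ≤ Bε ε)
    (hBεβ : ∀ ε β, 0 < ε → ε ≤ 1 → 0 ≤ β → β < 1 →
      inputConst45 d₁ δ₁ α₁ NI NF L₀ (holderConst d₁ δ₁ α₁ NH NF C (Bl β) (θH β)) (BI2 ε β) (θI (β + ε)) ≤ Bεβ ε β)
    (h261 : ∀ i, ML ≤ (geo i).M → Ineq261 d₁ (toB6 (geo i) (R i) (H i)) δ₁ α₁)
    (hF₁ : ∀ i, MF ≤ (geo i).M → Facts347 (geo i) (R i) (H i) d₁' δ₁ α₁ L₀)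
    (hop : ∀ i, M₁ ≤ (geo i).M → ∀ α₀ : ℝ, 0 < α₀ → c35 * (geo i).M * α₀ ≤ a₁ →
      ∀ U : (bg i).Cfg, (bg i).Reg335 c35 α₀ U →
        Factors389 (𝔬 i) (R i) (H i) θ₀ δ₁ U ∧ Identities310 (𝔬 i) (R i) (H i) U ∧
          HolderLegs310 (𝔬 i) (𝔭 i) (R i) (H i) (SH i) Bl δ₁ U ∧ FactorsHolder310 (𝔬 i) (𝔭 i) (R i) (H i) θH δ₁ U)
    (hopL : ∀ i, M₁ ≤ (geo i).M → ∀ α₀ : ℝ, 0 < α₀ → c35 * (geo i).M * α₀ ≤ a₁ →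
      ∀ U : (bg i).Cfg, (bg i).Reg335 c35 α₀ U → LapLegs310 (𝔬 i) (R i) (H i) (SL i) BL δ₁ U)
    (hopI : ∀ i, M₁ ≤ (geo i).M → ∀ α₀ : ℝ, 0 < α₀ → c35 * (geo i).M * α₀ ≤ a₁ →
      ∀ U : (bg i).Cfg, (bg i).Reg335 c35 α₀ U →
        InputLegs310 (𝔬 i) (𝔭 i) (R i) (H i) (bH i) (SI i) BI BI2 δ₁ U ∧ FactorsInput310 (𝔬 i) (R i) (H i) (bH i) θI δ₁ U)
    -- the displayed residual: the L² line n = 4 only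
    (hrest : ∀ i, Mr ≤ (geo i).M → ∀ α₀ : ℝ, 0 < α₀ → (geo i).M * α₀ ≤ ar → ∀ U : (bg i).Cfg, (bg i).Reg335 c35 α₀ U →
      ∀ (lam : (geo i).Loc) (h : (geo i).Cut) (y y' : (geo i).Site), (geo i).cutIn h y → (geo i).suppIn lam y' →
        (K i).l2 4 U lam h ≤ B₀ * B9.pref6 ((geo i).len y) 4 * (geo i).cutSup h * Real.exp (-(δ₀ * (geo i).dist y y')) *
          (geo i).l2Norm lam) :
    B9.Thm310Printed c35 geo bg
      (fun i => W310OfOps (𝔬 i) (rd i) (ConvAll3107 (𝔬 i) (R i) (H i) C δ (K i) B₀ δ₀ Bβ Bε Bεβ)) := by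
  have hαδ₁ : 0 ≤ α₁ * δ₁ := mul_nonneg hα₁ hδ₁
  have hδδ₁ : δ ≤ (1 - α₁) * δ₁ := hδ5.trans (by nlinarith [hαδ₁])
  have hα₁1 : α₁ ≤ 1 := by linarith
  have h310' := h310
  obtain ⟨M₂, a₀, δc, Cc, cc, hM₂, ha₀, -, -, -, hE⟩ := h310'
  set Mbig : ℝ := 2 * NF * θ₀ * B6.c1 d₁ δ₁ α₁ with hMbig
  refine thm310Printed_allPin_schur_holder_lap (Mr := max (max (max Mr Mg) 1) (max (max M₂ M₁) (max (max ML MF) Mbig)))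
    (ar := min (min ar a₀) (a₁ / c35)) 𝔭 K ev evY κ SH Bl θH d₁ δ₁ α₁ ρ N N' NF Cℓ θ₀ NH a₁ M₁ ML SL NL BL MF d₁' h310 hco0
    hco1 hco2 hco3 hgl0 hgl1 hgl2 hgl3 hl0 hl1 hl2 hl3 hl5 hH1 hsym htr hadjL hfacts hdsymm hC hCB hCL hδ₀ hα hCg
    (lt_min (lt_min har ha₀) (div_pos ha₁ hc)) hc ha₁ hα₁ hα₁2 hNF hθ₀ hNH hδnn hδ5 hδ₁ hNL hBL hB5 hst hcntH hcntL hBl hθH hBβ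
    h261 hF₁ hop hopL fun i hM α₀ hα₀ hMa U hU => ?_
  have hMr : Mr ≤ (geo i).M := le_trans (le_trans (le_trans (le_max_left _ _) (le_max_left _ _)) (le_max_left _ _)) hM
  have hMg : Mg ≤ (geo i).M := le_trans (le_trans (le_trans (le_max_right _ _) (le_max_left _ _)) (le_max_left _ _)) hM
  have hM1 : 1 ≤ (geo i).M := le_trans (le_trans (le_max_right _ _) (le_max_left _ _)) hM
  have hM₂i : M₂ ≤ (geo i).M := le_trans (le_trans (le_trans (le_max_left _ _) (le_max_left _ _)) (le_max_right _ _)) hM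
  have hM₁i : M₁ ≤ (geo i).M := le_trans (le_trans (le_trans (le_max_right _ _) (le_max_left _ _)) (le_max_right _ _)) hM
  have hMLi : ML ≤ (geo i).M :=
    le_trans (le_trans (le_trans (le_trans (le_max_left _ _) (le_max_left _ _)) (le_max_right _ _)) (le_max_right _ _)) hM
  have hMFi : MF ≤ (geo i).M :=
    le_trans (le_trans (le_trans (le_trans (le_max_right _ _) (le_max_left _ _)) (le_max_right _ _)) (le_max_right _ _)) hM
  have hMb : Mbig ≤ (geo i).M := le_trans (le_trans (le_trans (le_max_right _ _) (le_max_right _ _)) (le_max_right _ _)) hM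
  have hMpos : 0 < (geo i).M := lt_of_lt_of_le one_pos hM1
  have hMa_ar : (geo i).M * α₀ ≤ ar := hMa.trans ((min_le_left _ _).trans (min_le_left _ _))
  have hMa₀ : (geo i).M * α₀ ≤ a₀ := hMa.trans ((min_le_left _ _).trans (min_le_right _ _))
  have ha : c35 * (geo i).M * α₀ ≤ a₁ := by
    have h1 : (geo i).M * α₀ * c35 ≤ a₁ := (le_div_iff₀ hc).mp (hMa.trans (min_le_right _ _))
    calc c35 * (geo i).M * α₀ = (geo i).M * α₀ * c35 := by ring
      _ ≤ a₁ := h1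
  have h4 := hrest i hMr α₀ hα₀ hMa_ar U hU
  have hconv : Conv3107 (𝔬 i) (R i) (H i) C δ U := (hE i hM₂i α₀ hα₀ hMa₀ U hU).1
  obtain ⟨-, h1, h2, -⟩ := hconv
  obtain ⟨hf, hi, hL, hFH⟩ := hop i hM₁i α₀ hα₀ ha U hU
  obtain ⟨hIL, hFI⟩ := hopI i hM₁i α₀ hα₀ ha U hU
  have hq : NF * (θ₀ * ((geo i).M)⁻¹) * B6.c1 d₁ δ₁ α₁ ≤ 1 / 2 := small_of_threshold₃ hMpos (by rw [hMbig] at hMb; exact hMb)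
  have hF := hfacts i hMg
  have hL₀ : 0 ≤ L₀ := le_trans (le_trans zero_le_one hF.one_le_L) hF.L_le
  have hlen : ∀ y : (geo i).Site, 0 < (geo i).len y := (hst i).lenpos
  obtain ⟨h44, h45⟩ := input3445_of_local310 (𝔬 i) (𝔭 i) (R i) (H i) (bH i) d d₁ δ α L₀ δ₁ α₁ ρ N N' NF Cℓ θ₀ NH NI C
    (κ i) (SH i) (SI i) Bl θH BI θI BI2 U hδ₁ hα₁ hα₁1 hNF hθ₀ hNH hNI hM1 hC hδnn hδδ₁ hα hαδ1 (hst i) (hcntH i) (hcntI i)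
    hBl hθH hBI hBI2 hθI (h261 i hMLi) hF hq hf hi hL hFH hIL hFI h1 h2
  have hexp : ∀ a b : (geo i).Site, Real.exp (-((1 - α) * δ * (geo i).dist a b)) ≤ Real.exp (-(δ₀ * (geo i).dist a b)) :=
    fun a b => Real.exp_le_exp.mpr (neg_le_neg (mul_le_mul_of_nonneg_right hδ₀ ((hst i).dnn a b)))
  have hc1 : 0 ≤ B6.c1 d₁ δ₁ α₁ := c1_nonneg d₁ δ₁ α₁
  have hK44 : ∀ ε, 0 < ε → ε ≤ 1 → 0 ≤ inputConst44 d₁ δ₁ α₁ NI NF C L₀ (BI ε) (θI ε) := by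
    intro ε hε0 hε1
    have hb := hBI ε hε0 hε1
    have ht := hθI ε hε0
    unfold inputConst44
    positivity
  have hK45 : ∀ ε β, 0 < ε → ε ≤ 1 → 0 ≤ β → β < 1 →
      0 ≤ inputConst45 d₁ δ₁ α₁ NI NF L₀ (holderConst d₁ δ₁ α₁ NH NF C (Bl β) (θH β)) (BI2 ε β) (θI (β + ε)) := by
    intro ε β hε0 hε1 hβ0 hβ1
    have hb := hBI2 ε β hε0 hε1 hβ0 hβ1
    have ht := hθI (β + ε) (by linarith)
    have hbl := hBl β hβ0 hβ1
    have hth := hθH β hβ0 hβ1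
    unfold inputConst45 holderConst
    positivity
  have h44' : ∀ ε, 0 < ε → ε ≤ 1 → HasMaj (bH i ε) (BlockNorm.ofBlocks (toB6 (geo i) (R i) (H i)) (𝔬 i).blkY)
      ((𝔬 i).D U ∘ₗ ((𝔬 i).G U ∘ₗ (𝔬 i).Dstar U)) (fun (a b : (geo i).Site) => Bε ε * Real.exp (-(δ₀ * (geo i).dist a b))) :=
    fun ε hε0 hε1 => (h44 ε hε0 hε1).mono fun a b =>
      mul_le_mul (hBε ε hε0 hε1) (hexp a b) (Real.exp_nonneg _) ((hK44 ε hε0 hε1).trans (hBε ε hε0 hε1))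
  have h45' : ∀ ε β, 0 < ε → ε ≤ 1 → 0 ≤ β → β < 1 →
      HasMaj (bH i (β + ε)) (BlockNorm.ofBlocks (toB6 (geo i) (R i) (H i)) (𝔭 i).blkPY)
        ((𝔭 i).ΦY U β ∘ₗ ((𝔬 i).D U ∘ₗ ((𝔬 i).G U ∘ₗ (𝔬 i).Dstar U)))
        (fun (a b : (geo i).Site) => Bεβ ε β * (geo i).len a ^ (-β) * Real.exp (-(δ₀ * (geo i).dist a b))) := by
    intro ε β hε0 hε1 hβ0 hβ1
    refine (h45 ε β hε0 hε1 hβ0 hβ1).mono fun a b => ?_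
    have hW : 0 ≤ (geo i).len a ^ (-β) := Real.rpow_nonneg (hlen a).le _
    exact mul_le_mul (mul_le_mul_of_nonneg_right (hBεβ ε β hε0 hε1 hβ0 hβ1) hW) (hexp a b) (Real.exp_nonneg _)
      (mul_nonneg ((hK45 ε β hε0 hε1 hβ0 hβ1).trans (hBεβ ε β hε0 hε1 hβ0 hβ1)) hW)
  have hBε0 : ∀ ε, 0 < ε → ε ≤ 1 → 0 ≤ Bε ε := fun ε hε0 hε1 => (hK44 ε hε0 hε1).trans (hBε ε hε0 hε1)
  have hBεβ0 : ∀ ε β, 0 < ε → ε ≤ 1 → 0 ≤ β → β < 1 → 0 ≤ Bεβ ε β := fun ε β hε0 hε1 hβ0 hβ1 =>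
    (hK45 ε β hε0 hε1 hβ0 hβ1).trans (hBεβ ε β hε0 hε1 hβ0 hβ1)
  obtain ⟨h344, h345⟩ := lines3445_of_hasMaj (hIR i U) hBε0 hBεβ0 hlen h44' h45'
  exact ⟨h344, h345, h4⟩

end AllPinsG

end

end Literature.MathematicalPhysics.QuantumFieldTheory.Balaban1983to89.B9RWSums344Input
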